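import Summits.QuantumFields.YangMills.Theorems.LuscherReductionOneSiteLevelsValleyChartNear

/-!
# VALLEY, step 4c: the NEAR exponent bound in the gnomonic chart, and the kinetic defect in the chart
# (support module for `stub_absUpperValleyMag` of crux `OneSiteLevels`, route `LuscherReduction`, item stmt-QuantumFields-20007;
# fleet lead prover ym-luscher-20007-p1 g2)

Pointwise bounds for the integrand of the VALLEY supersolution quantity `J_τ(U)` after the gnomonic substitution `V = U·W(y)`,
`W(y) = gnChart 1 σ₀ y` (all links in the upper hemisphere):
* §1 `(1+s)^{-1/2} ≤ 1 − s/2 + 3s²/8` (`inv_sqrt_le_taylor`), hence the kinetic defect `D(W(y)) = Σ_i 2(1 − (1+|y_i|²)^{-1/2})` obeys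
  `(1 − 3η/4)‖y‖² ≤ D(W(y)) ≤ ‖y‖²` when `|y_i|² ≤ η` (`sumDefect_gnChart_ge`), `|y_i|² ≤ 3δ'` on `{D ≤ δ'}` (`csq_le_of_sumDefect_le`), and
  `D > 2` on every other hemisphere pattern (`two_lt_sumDefect_gnChart_of_ne`);
* §2 THE NEAR EXPONENT BOUND (`near_exponent_le`): for `|y_i|² ≤ η ≤ 1/12` and `½ + τ ≥ 0`,
  `(τ−½)S(U) + Σ_e Re tr(U_e(U·W)_e⁻¹) − (½+τ)S(U·W(y))`
  `≤ 6 − S(U)(1 − 6η(½+τ)) − ‖y‖²(1 − 3η/4 − (½+τ)(2√2√S(U) + 3η(2+12η))) − (½+τ)·G_U(y) − (½+τ)(1−12η)·Q_U(y)`,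
  with the linear gradient term `G_U(y) = 4Σ c·ℓ(y)` and the transverse Hessian `Q_U(y) = Σ|ℓ(y)|²` of `…ValleyChartNear`.

## WHAT THIS IS NOT
Pointwise algebra/calculus only; NOT the valley estimate, NOT the crux, NOT THE CLAY GAP.  Sorry-free; no new definition, no named fact.
-/

set_option autoImplicit false

noncomputable section

open MeasureTheory Filter Topology Real
open scoped Matrix Quaternion RealInnerProductSpace BigOperators
open Literature.MathematicalPhysics.QuantumFieldTheory
open Literature.MathematicalPhysics.QuantumLattice
open Literature.Analysis.OperatorTheory.YMMatrixModel
open Literature.MathematicalPhysics.QuantumFieldTheory.Balaban1983to89.T4CubeChartGnomonic (gnoPoint)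

namespace Summit.QuantumFields.YangMills.Theorems.FemtoTransferGap

/-! ### §1. The kinetic defect in the chart -/

/-- `(1+s)^{-1/2} ≤ 1 − s/2 + 3s²/8` for `s ≥ 0` (`(1 − s/2 + 3s²/8)²(1+s) = 1 + s³(40 − 15s + 9s²)/64 ≥ 1`). [folklore] -/
theorem inv_sqrt_le_taylor {s : ℝ} (hs : 0 ≤ s) : (Real.sqrt (1 + s))⁻¹ ≤ 1 - s / 2 + 3 / 8 * s ^ 2 := by
  have h1 : 0 < Real.sqrt (1 + s) := Real.sqrt_pos.2 (by linarith)
  have ht : 0 < 1 - s / 2 + 3 / 8 * s ^ 2 := by nlinarith [sq_nonneg (s - 2 / 3)]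
  rw [inv_eq_one_div, div_le_iff₀ h1]
  have hsq : Real.sqrt (1 + s) ^ 2 = 1 + s := Real.sq_sqrt (by linarith)
  have key : 1 ≤ ((1 - s / 2 + 3 / 8 * s ^ 2) * Real.sqrt (1 + s)) ^ 2 := by
    rw [mul_pow, hsq]
    nlinarith [sq_nonneg s, mul_nonneg hs (sq_nonneg s), mul_nonneg (mul_nonneg hs hs) (sq_nonneg (s - 1)),
      mul_nonneg hs (mul_nonneg hs hs)]
  nlinarith [mul_pos ht h1]

/-- Per link: `s(1 − 3s/4) ≤ 2(1 − (1+s)^{-1/2}) ≤ s` for `s ≥ 0`. [folklore] -/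
theorem two_mul_one_sub_inv_sqrt_bounds {s : ℝ} (hs : 0 ≤ s) :
    s - 3 / 4 * s ^ 2 ≤ 2 * (1 - (Real.sqrt (1 + s))⁻¹) ∧ 2 * (1 - (Real.sqrt (1 + s))⁻¹) ≤ s := by
  constructor
  · have := inv_sqrt_le_taylor hs; linarith
  · have := one_sub_half_le_inv_sqrt hs; linarith

/-- On `{2(1 − (1+s)^{-1/2}) ≤ δ'}` with `δ' ≤ 1`: `s ≤ 3δ'`. [folklore] -/
theorem le_of_two_mul_one_sub_inv_sqrt_le {s δ' : ℝ} (hs : 0 ≤ s) (hδ' : δ' ≤ 1) (h : 2 * (1 - (Real.sqrt (1 + s))⁻¹) ≤ δ') :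
    s ≤ 3 * δ' := by
  set r := Real.sqrt (1 + s) with hr
  have hr0 : 0 < r := Real.sqrt_pos.2 (by linarith)
  have hr1 : 1 ≤ r := by rw [hr]; exact Real.one_le_sqrt.2 (by linarith)
  have hrsq : r ^ 2 = 1 + s := Real.sq_sqrt (by linarith)
  -- `1 − 1/r ≤ δ'/2 ≤ 1/2` ⇒ `r ≤ 2`, and `s = r² − 1 = (r−1)(r+1) ≤ 3(r−1) = 3r(1 − 1/r) ≤ 6(1−1/r) ≤ 3δ'`
  have hinv : 1 - r⁻¹ ≤ δ' / 2 := by linarith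
  have hr2 : r ≤ 2 := by
    have : r⁻¹ ≥ 1 / 2 := by linarith
    rw [ge_iff_le, div_le_iff₀ (by norm_num : (0:ℝ) < 2), inv_mul_eq_div, le_div_iff₀ hr0] at this
    linarith
  have e : r * (1 - r⁻¹) = r - 1 := by field_simp
  nlinarith [mul_le_mul_of_nonneg_left hinv hr0.le]

/-- **The kinetic defect of the all-upper chart**: `D(gnChart 1 σ₀ y) = Σ_i 2(1 − (1+|y_i|²)^{-1/2})`. [folklore] -/
theorem sumDefect_gnChart_eq (y : ZM) :
    ∑ e : Edge 3 1, (2 - 2 * scalarPart (gnChart 1 (fun _ => false) y e))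
      = ∑ i : Fin 3, 2 * (1 - (Real.sqrt (1 + vsq (colourVec y i)))⁻¹) := by
  rw [sum_edge_eq_sum_fin]
  refine Finset.sum_congr rfl fun i _ => ?_
  rw [gnChart_upper_apply, scalarPart_gnoPoint, ← Real.sqrt_sq (norm_nonneg (gnomonicQuat (colourVec y i))), norm_gnomonicQuat_sq]
  ring

/-- `vsq (colourVec y i) = csq i y` and `Σ_i vsq(y_i) = ‖y‖²`. [folklore] -/
theorem sum_vsq_colourVec (y : ZM) : ∑ i : Fin 3, vsq (colourVec y i) = ‖y‖ ^ 2 := by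
  rw [norm_sq_eq_sum_csq]
  exact Finset.sum_congr rfl fun i _ => by rw [vsq, csq_eq_sum]; rfl

/-- **Two-sided chart bound on the defect**: if `|y_i|² ≤ η` for all `i` then `(1 − 3η/4)‖y‖² ≤ D(W(y)) ≤ ‖y‖²`. [folklore] -/
theorem sumDefect_gnChart_bounds (y : ZM) {η : ℝ} (hy : ∀ i, vsq (colourVec y i) ≤ η) :
    (1 - 3 / 4 * η) * ‖y‖ ^ 2 ≤ ∑ e : Edge 3 1, (2 - 2 * scalarPart (gnChart 1 (fun _ => false) y e))
      ∧ ∑ e : Edge 3 1, (2 - 2 * scalarPart (gnChart 1 (fun _ => false) y e)) ≤ ‖y‖ ^ 2 := by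
  rw [sumDefect_gnChart_eq, ← sum_vsq_colourVec, Finset.mul_sum]
  constructor
  · refine Finset.sum_le_sum fun i _ => ?_
    have h0 := vsq_nonneg (colourVec y i)
    have := (two_mul_one_sub_inv_sqrt_bounds h0).1
    nlinarith [hy i]
  · exact Finset.sum_le_sum fun i _ => (two_mul_one_sub_inv_sqrt_bounds (vsq_nonneg _)).2

/-- **On the kinetic ball** `{D(W(y)) ≤ δ'}` (`δ' ≤ 1`) every block is small: `|y_i|² ≤ 3δ'`. [folklore] -/
theorem vsq_le_of_sumDefect_le (y : ZM) {δ' : ℝ} (hδ' : δ' ≤ 1)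
    (h : ∑ e : Edge 3 1, (2 - 2 * scalarPart (gnChart 1 (fun _ => false) y e)) ≤ δ') (i : Fin 3) :
    vsq (colourVec y i) ≤ 3 * δ' := by
  rw [sumDefect_gnChart_eq] at h
  have hi : 2 * (1 - (Real.sqrt (1 + vsq (colourVec y i)))⁻¹) ≤ δ' := by
    refine le_trans (Finset.single_le_sum (f := fun j : Fin 3 => 2 * (1 - (Real.sqrt (1 + vsq (colourVec y j)))⁻¹))
      (fun j _ => ?_) (Finset.mem_univ i)) h
    have := (two_mul_one_sub_inv_sqrt_bounds (vsq_nonneg (colourVec y j))).1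
    nlinarith [vsq_nonneg (colourVec y j), sq_nonneg (vsq (colourVec y j)),
      inv_sqrt_le_taylor (vsq_nonneg (colourVec y j)), one_sub_half_le_inv_sqrt (vsq_nonneg (colourVec y j)),
      Real.sqrt_pos.2 (show (0:ℝ) < 1 + vsq (colourVec y j) by linarith [vsq_nonneg (colourVec y j)]),
      inv_le_one_of_one_le₀ (Real.one_le_sqrt.2 (show (1:ℝ) ≤ 1 + vsq (colourVec y j) by linarith [vsq_nonneg (colourVec y j)]))]
  exact le_of_two_mul_one_sub_inv_sqrt_le (vsq_nonneg _) hδ' hi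

/-- **Other hemisphere patterns are far**: if `σ ≠ σ₀` then `D(gnChart 1 σ y) > 2`. [folklore] -/
theorem two_lt_sumDefect_gnChart_of_ne (y : ZM) {σ : Fin 3 → Bool} (hσ : σ ≠ fun _ => false) :
    2 < ∑ e : Edge 3 1, (2 - 2 * scalarPart (gnChart 1 σ y e)) := by
  obtain ⟨i, hi⟩ : ∃ i, σ i = true := by
    by_contra h
    push Not at h
    exact hσ (funext fun i => by simpa using h i)
  rw [sum_edge_eq_sum_fin]
  have hterm : ∀ j : Fin 3, 0 ≤ 2 - 2 * scalarPart (gnChart 1 σ y (edgeOf j)) := fun j => two_sub_two_mul_scalarPart_nonneg _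
  have hi' : 2 < 2 - 2 * scalarPart (gnChart 1 σ y (edgeOf i)) := by
    have hlink : gnChart 1 σ y (edgeOf i) = negOne * gnoPoint (fun a => 1 * y (i, a)) := by
      simp [gnChart, hemi, edgeOf, hi]
    rw [hlink, scalarPart_negOne_mul]
    have := scalarPart_gnoPoint_pos (fun a => 1 * y (i, a))
    linarith
  calc (2:ℝ) < 2 - 2 * scalarPart (gnChart 1 σ y (edgeOf i)) := hi'
    _ ≤ ∑ j : Fin 3, (2 - 2 * scalarPart (gnChart 1 σ y (edgeOf j))) :=
        Finset.single_le_sum (f := fun j : Fin 3 => 2 - 2 * scalarPart (gnChart 1 σ y (edgeOf j))) (fun j _ => hterm j)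
          (Finset.mem_univ i)

/-! ### §2. The NEAR exponent bound -/

/-- **THE NEAR EXPONENT BOUND.**  For `½ + τ ≥ 0`, `0 ≤ η ≤ 1/12` and `|y_i|² ≤ η` (`i = 1,2,3`):
`(τ−½)S(U) + Σ_e Re tr(U_e (U·W(y))_e⁻¹) − (½+τ) S(U·W(y))`
`≤ 6 − S(U)(1 − 6η(½+τ)) − ‖y‖²(1 − 3η/4 − (½+τ)(2√2 √S(U) + 3η(2+12η))) − (½+τ)·4Σ c·ℓ(y) − (½+τ)(1 − 12η)·Σ|ℓ(y)|²`
(`W(y) = gnChart 1 σ₀ y`; `c, ℓ` as in `…ValleyChartNear`). [cite: SimonB1983DiscreteSpectrum, §2] [cite: Luscher1983, §2] -/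
theorem near_exponent_le (τ : ℝ) (hτ : 0 ≤ 1 / 2 + τ) (U : Cfg) (y : ZM) {η : ℝ} (hη0 : 0 ≤ η)
    (hy : ∀ i, vsq (colourVec y i) ≤ η) :
    (τ - 1 / 2) * wilsonAction su2Rep U + timeCoupling su2Rep U (U * gnChart 1 (fun _ => false) y)
        - (1 / 2 + τ) * wilsonAction su2Rep (U * gnChart 1 (fun _ => false) y)
      ≤ 6 - wilsonAction su2Rep U * (1 - 6 * η * (1 / 2 + τ))
        - ‖y‖ ^ 2 * (1 - 3 / 4 * η - (1 / 2 + τ) * (2 * Real.sqrt 2 * √(wilsonAction su2Rep U) + 3 * η * (2 + 12 * η)))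
        - (1 / 2 + τ) * (4 * ∑ p : Fin 3 × Fin 3, (vecPart (U (edgeOf p.1)) ⨯₃ vecPart (U (edgeOf p.2))) ⬝ᵥ
          (vecPart (U (edgeOf p.1)) ⨯₃ (scalarPart (U (edgeOf p.2)) • colourVec y p.2 + vecPart (U (edgeOf p.2)) ⨯₃ colourVec y p.2)
            + (scalarPart (U (edgeOf p.1)) • colourVec y p.1 + vecPart (U (edgeOf p.1)) ⨯₃ colourVec y p.1) ⨯₃ vecPart (U (edgeOf p.2))))
        - (1 / 2 + τ) * (1 - 12 * η) * (∑ p : Fin 3 × Fin 3,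
          (vecPart (U (edgeOf p.1)) ⨯₃ (scalarPart (U (edgeOf p.2)) • colourVec y p.2 + vecPart (U (edgeOf p.2)) ⨯₃ colourVec y p.2)
            + (scalarPart (U (edgeOf p.1)) • colourVec y p.1 + vecPart (U (edgeOf p.1)) ⨯₃ colourVec y p.1) ⨯₃ vecPart (U (edgeOf p.2)))
          ⬝ᵥ (vecPart (U (edgeOf p.1)) ⨯₃ (scalarPart (U (edgeOf p.2)) • colourVec y p.2 + vecPart (U (edgeOf p.2)) ⨯₃ colourVec y p.2)
            + (scalarPart (U (edgeOf p.1)) • colourVec y p.1 + vecPart (U (edgeOf p.1)) ⨯₃ colourVec y p.1) ⨯₃ vecPart (U (edgeOf p.2)))) := by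
  have hD := (sumDefect_gnChart_bounds y hy).1
  have hS := wilsonAction_mul_gnChart_ge U y hη0 hy
  obtain ⟨hG, hCQ, hQQ, hQ⟩ := step_size_bounds U y
  rw [timeCoupling_mul_eq]
  have hR0 : 0 ≤ ∑ p : Fin 3 × Fin 3,
          (((scalarPart (U (edgeOf p.1)) • colourVec y p.1 + vecPart (U (edgeOf p.1)) ⨯₃ colourVec y p.1)
            ⨯₃ (scalarPart (U (edgeOf p.2)) • colourVec y p.2 + vecPart (U (edgeOf p.2)) ⨯₃ colourVec y p.2)))
          ⬝ᵥ (((scalarPart (U (edgeOf p.1)) • colourVec y p.1 + vecPart (U (edgeOf p.1)) ⨯₃ colourVec y p.1)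
            ⨯₃ (scalarPart (U (edgeOf p.2)) • colourVec y p.2 + vecPart (U (edgeOf p.2)) ⨯₃ colourVec y p.2))) :=
    Finset.sum_nonneg fun p _ => by exact Finset.sum_nonneg fun _ _ => mul_self_nonneg _
  have hS00 : 0 ≤ wilsonAction su2Rep U := wilsonAction_su2_nonneg U
  -- abbreviations
  set S0 := wilsonAction su2Rep U with hS0
  set S1 := wilsonAction su2Rep (U * gnChart 1 (fun _ => false) y) with hS1
  set Dv := ∑ e : Edge 3 1, (2 - 2 * scalarPart (gnChart 1 (fun _ => false) y e)) with hDv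
  set Gv := ∑ p : Fin 3 × Fin 3, (vecPart (U (edgeOf p.1)) ⨯₃ vecPart (U (edgeOf p.2))) ⬝ᵥ
          (vecPart (U (edgeOf p.1)) ⨯₃ (scalarPart (U (edgeOf p.2)) • colourVec y p.2 + vecPart (U (edgeOf p.2)) ⨯₃ colourVec y p.2)
            + (scalarPart (U (edgeOf p.1)) • colourVec y p.1 + vecPart (U (edgeOf p.1)) ⨯₃ colourVec y p.1) ⨯₃ vecPart (U (edgeOf p.2))) with hGv
  set Cv := ∑ p : Fin 3 × Fin 3, (vecPart (U (edgeOf p.1)) ⨯₃ vecPart (U (edgeOf p.2))) ⬝ᵥ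
          ((scalarPart (U (edgeOf p.1)) • colourVec y p.1 + vecPart (U (edgeOf p.1)) ⨯₃ colourVec y p.1)
            ⨯₃ (scalarPart (U (edgeOf p.2)) • colourVec y p.2 + vecPart (U (edgeOf p.2)) ⨯₃ colourVec y p.2)) with hCv
  set Qv := ∑ p : Fin 3 × Fin 3,
          (vecPart (U (edgeOf p.1)) ⨯₃ (scalarPart (U (edgeOf p.2)) • colourVec y p.2 + vecPart (U (edgeOf p.2)) ⨯₃ colourVec y p.2)
            + (scalarPart (U (edgeOf p.1)) • colourVec y p.1 + vecPart (U (edgeOf p.1)) ⨯₃ colourVec y p.1) ⨯₃ vecPart (U (edgeOf p.2)))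
          ⬝ᵥ (vecPart (U (edgeOf p.1)) ⨯₃ (scalarPart (U (edgeOf p.2)) • colourVec y p.2 + vecPart (U (edgeOf p.2)) ⨯₃ colourVec y p.2)
            + (scalarPart (U (edgeOf p.1)) • colourVec y p.1 + vecPart (U (edgeOf p.1)) ⨯₃ colourVec y p.1) ⨯₃ vecPart (U (edgeOf p.2))) with hQv
  set Rv := ∑ p : Fin 3 × Fin 3,
          (((scalarPart (U (edgeOf p.1)) • colourVec y p.1 + vecPart (U (edgeOf p.1)) ⨯₃ colourVec y p.1)
            ⨯₃ (scalarPart (U (edgeOf p.2)) • colourVec y p.2 + vecPart (U (edgeOf p.2)) ⨯₃ colourVec y p.2)))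
          ⬝ᵥ (((scalarPart (U (edgeOf p.1)) • colourVec y p.1 + vecPart (U (edgeOf p.1)) ⨯₃ colourVec y p.1)
            ⨯₃ (scalarPart (U (edgeOf p.2)) • colourVec y p.2 + vecPart (U (edgeOf p.2)) ⨯₃ colourVec y p.2))) with hRv
  clear_value S0 S1 Dv Gv Cv Qv Rv
  have hy2 : ‖y‖ ^ 2 ≤ 3 * η := by
    rw [← sum_vsq_colourVec]
    calc ∑ i : Fin 3, vsq (colourVec y i) ≤ ∑ _i : Fin 3, η := Finset.sum_le_sum fun i _ => hy i
      _ = 3 * η := by simp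
  have hy0 : 0 ≤ ‖y‖ ^ 2 := sq_nonneg _
  -- the mixed term and the quartic term
  have hsq2 : √(S0 / 2) = √S0 / Real.sqrt 2 := by rw [Real.sqrt_div hS00]
  have hsq' : √(S0 / 2) = Real.sqrt 2 * √S0 / 2 := by
    rw [hsq2]; field_simp; rw [Real.sq_sqrt (by norm_num : (0:ℝ) ≤ 2)]
  have hC' : -(4 * Cv) ≤ 2 * Real.sqrt 2 * √S0 * ‖y‖ ^ 2 := by
    have h1 := neg_abs_le Cv
    rw [hsq'] at hCQ
    nlinarith [hCQ, h1]
  have hR' : Rv ≤ 3 * η * ‖y‖ ^ 2 := by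
    calc Rv ≤ ‖y‖ ^ 4 := hQQ
      _ = ‖y‖ ^ 2 * ‖y‖ ^ 2 := by ring
      _ ≤ 3 * η * ‖y‖ ^ 2 := mul_le_mul_of_nonneg_right hy2 hy0
  -- multiply the action lower bound by `(½+τ) ≥ 0`
  have hmono := mul_le_mul_of_nonneg_left hS hτ
  have hC2 := mul_le_mul_of_nonneg_left hC' hτ
  have hR2 : (1 / 2 + τ) * ((2 + 12 * η) * Rv) ≤ (1 / 2 + τ) * ((2 + 12 * η) * (3 * η * ‖y‖ ^ 2)) :=
    mul_le_mul_of_nonneg_left (mul_le_mul_of_nonneg_left hR' (by linarith)) hτ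
  nlinarith [hmono, hC2, hR2, hD]

end Summit.QuantumFields.YangMills.Theorems.FemtoTransferGap

end
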